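import Mathlib.Analysis.Calculus.FDeriv.Analytic
import Literature.Geometry.Kaehler.ManifoldFormsChart
import Literature.NumberTheory.Transcendental.ComplexForms
import HarnessLib

/-!
# Holomorphic forms in local holomorphic coordinates; top-degree holomorphic forms are closed

Family `hodge` / trunk Kähler, layer `Literature/Geometry/Kaehler`. Let `M` be a complex manifold
charted on the complex normed space `E` (real model `𝓘(ℝ, E)`, complex `k`-forms
`MForm 𝓘(ℝ, E) M ℂ k` as in `Literature/NumberTheory/Transcendental/ComplexForms`).

* `Literature.Geometry.Kaehler.IsHolomorphicInCharts η`: the complex `k`-form `η` is, in the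
  preferred chart at every point, the germ of a complex-analytic function with values in the
  `ℂ`-multilinear alternating `k`-forms on `E` (read as real forms by restriction of scalars).
  This is the local-coordinate description of a holomorphic section of `Ω^k_M = Λ^k T^{*1,0}M`
  (Huybrechts, Def. 2.2.14: `Ω^p_X := Λ^p Ω_X`, `K_X := Ω^n_X`; Voisin I, §2.3: in holomorphic
  coordinates `η = Σ_I η_I dz_I` with holomorphic `η_I`), i.e. of a **holomorphic `k`-form**.
  The tree's global predicate `Literature.NumberTheory.Transcendental.IsHolomorphicForm`
  (file `Dolbeault`: smooth, of type `(k,0)`, `∂̄`-closed) is the other side of Huybrechts'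
  Prop. 2.6.11 `H⁰(X, Ω^p_X) = {α ∈ A^{p,0}(X) | ∂̄α = 0}`; that equivalence needs the type
  decomposition of forms (named facts of `ComplexForms`) and is NOT proved here. The present
  chart-level predicate is the one an explicit construction (residues, pulled-back coordinate
  forms) verifies directly, and from it we PROVE what the Hodge-theoretic consumers use:
* `IsHolomorphicInCharts.isSmoothForm`: holomorphic forms are smooth;
* `IsHolomorphicInCharts.isOfType`: a holomorphic `k`-form has type `(k,0)`
  (`ℂ`-multilinear forms have weight `k` under `v ↦ e^{iθ}v`);
* `IsHolomorphicInCharts.isClosedForm`: on a complex manifold of dimension `k = dim_ℂ E`, a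
  holomorphic `k`-form is `d`-closed — Voisin I, proof of Cor. 7.6, case `p = n`: `dη = ∂η` is of
  type `(n+1,0)`, hence zero "for reasons of type"; here: `dη(x)` is the alternatisation of a
  `ℂ`-linear derivative with `ℂ`-multilinear values, a `ℂ`-alternating `(k+1)`-form on the
  `k`-dimensional `E`, which kills the necessarily dependent `k+1` arguments
  (`continuousAlternatingMap_apply_eq_zero_of_finrank_lt`).

Only the real `C^∞` atlas `[IsManifold 𝓘(ℝ, E) ∞ M]` is needed for the proofs (through
`MForm.inChart_apply_self` and `mextDeriv_eq_extDerivWithin` of `ManifoldFormsChart`); the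
predicate has its intended meaning when the atlas is holomorphic.

## References

* D. Huybrechts, *Complex Geometry* (2005), Def. 2.2.14, Prop. 2.6.11.
* C. Voisin, *Hodge Theory and Complex Algebraic Geometry I* (2002), §2.3.1, Cor. 7.6.
-/

noncomputable section

open scoped Manifold ContDiff Topology
open Set Filter

namespace Literature.Geometry.Kaehler

variable {E : Type*} [NormedAddCommGroup E] [NormedSpace ℂ E]
  {M : Type*} [TopologicalSpace M] [ChartedSpace E M] {k : ℕ}

/-- **Holomorphic `k`-form, in local holomorphic coordinates.** A complex `k`-form `η` on the
complex manifold `M` (charts valued in `E`) is *holomorphic in charts* if for every `x : M` the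
representative `η.inChart x` of `η` in the preferred chart at `x` coincides, near the centre
`extChartAt 𝓘(ℝ, E) x x`, with `y ↦ (g y).restrictScalars ℝ` for some function `g` with values
in the `ℂ`-multilinear alternating `k`-forms `E [⋀^Fin k]→L[ℂ] ℂ` which is complex analytic at
the centre: `η` is a holomorphic section of `Ω^k_M = Λ^k Ω_M` (Huybrechts, Def. 2.2.14), written
`Σ_{|I|=k} η_I dz_I` with holomorphic coefficients in holomorphic coordinates (Voisin I, §2.3.1).
Equivalent, on a complex manifold, to `Literature.NumberTheory.Transcendental.IsHolomorphicForm`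
(smooth `(k,0)`-form with `∂̄η = 0`; Huybrechts, Prop. 2.6.11 — not proved in the tree).
[cite: Huybrechts2005, Def. 2.2.14 and Prop. 2.6.11] -/
def IsHolomorphicInCharts (η : MForm 𝓘(ℝ, E) M ℂ k) : Prop :=
  ∀ x : M, ∃ g : E → E [⋀^Fin k]→L[ℂ] ℂ,
    AnalyticAt ℂ g (extChartAt 𝓘(ℝ, E) x x) ∧
      η.inChart x =ᶠ[𝓝 (extChartAt 𝓘(ℝ, E) x x)] fun y ↦ (g y).restrictScalars ℝ

/-- The zero form is holomorphic. [folklore] -/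
theorem isHolomorphicInCharts_zero : IsHolomorphicInCharts (0 : MForm 𝓘(ℝ, E) M ℂ k) :=
  fun _ ↦ ⟨0, analyticAt_const, Eventually.of_forall fun y ↦ by ext v; simp⟩

/-- Holomorphic forms are stable under addition (`Ω^k(M)` is a vector space). [folklore] -/
theorem IsHolomorphicInCharts.add {η η' : MForm 𝓘(ℝ, E) M ℂ k} (hη : IsHolomorphicInCharts η)
    (hη' : IsHolomorphicInCharts η') : IsHolomorphicInCharts (η + η') := fun x ↦ by
  obtain ⟨g, hg, heq⟩ := hη x
  obtain ⟨g', hg', heq'⟩ := hη' x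
  refine ⟨g + g', hg.add hg', ?_⟩
  rw [MForm.inChart_add]
  filter_upwards [heq, heq'] with y hy hy'
  rw [Pi.add_apply, hy, hy']
  ext v
  simp

/-- Holomorphic forms are stable under complex scalars (`Ω^k(M)` is a `ℂ`-vector space). [folklore] -/
theorem IsHolomorphicInCharts.smul (c : ℂ) {η : MForm 𝓘(ℝ, E) M ℂ k} (hη : IsHolomorphicInCharts η) :
    IsHolomorphicInCharts (c • η) := fun x ↦ by
  obtain ⟨g, hg, heq⟩ := hη x
  refine ⟨c • g, hg.const_smul, ?_⟩
  filter_upwards [heq] with y hy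
  have h : (c • η).inChart x y = c • η.inChart x y := rfl
  rw [h, hy]
  ext v
  simp

/-- Holomorphic forms are stable under negation. [folklore] -/
theorem IsHolomorphicInCharts.neg {η : MForm 𝓘(ℝ, E) M ℂ k} (hη : IsHolomorphicInCharts η) :
    IsHolomorphicInCharts (-η) := by
  simpa using hη.smul (-1)

/-- **Holomorphic forms are smooth**: a complex-analytic germ is real `C^∞`, so the chart
representatives of a holomorphic form are `C^∞` at the chart centres (Voisin I, §2.3.1:
holomorphic forms are particular `C^∞` forms of type `(k,0)`). [folklore] -/
theorem IsHolomorphicInCharts.isSmoothForm {η : MForm 𝓘(ℝ, E) M ℂ k}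
    (hη : IsHolomorphicInCharts η) : IsSmoothForm η := by
  intro x
  obtain ⟨g, hg, heq⟩ := hη x
  have h1 : ContDiffAt ℝ ∞ (fun y ↦ (g y).restrictScalars ℝ) (extChartAt 𝓘(ℝ, E) x x) := by
    have h3 : ContDiffAt ℝ ∞ g (extChartAt 𝓘(ℝ, E) x x) := (hg.contDiffAt (n := ∞)).restrict_scalars ℝ
    exact (ContinuousAlternatingMap.restrictScalarsCLM (𝕜 := ℂ) (E := E) (F := ℂ) (ι := Fin k)
      ℝ).contDiff.contDiffAt.comp _ h3
  exact (h1.congr_of_eventuallyEq heq).contDiffWithinAt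

/-- **A holomorphic form is pointwise `ℂ`-multilinear**: `η x` is (the restriction of scalars
of) a `ℂ`-multilinear alternating form, namely the value of the analytic germ at the centre of
the chart at `x` (where the representative is `η x` itself, `MForm.inChart_apply_self`).
[folklore] -/
theorem IsHolomorphicInCharts.exists_apply_eq_restrictScalars [IsManifold 𝓘(ℝ, E) ∞ M]
    {η : MForm 𝓘(ℝ, E) M ℂ k} (hη : IsHolomorphicInCharts η) (x : M) :
    ∃ a : E [⋀^Fin k]→L[ℂ] ℂ, η x = a.restrictScalars ℝ := by
  obtain ⟨g, _, heq⟩ := hη x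
  refine ⟨g (extChartAt 𝓘(ℝ, E) x x), ?_⟩
  rw [← MForm.inChart_apply_self η x]
  exact heq.eq_of_nhds

/-- **A holomorphic `k`-form has type `(k,0)`**: a `ℂ`-multilinear `k`-form satisfies
`a(e^{iθ}v₁, …, e^{iθ}v_k) = e^{ikθ} a(v₁, …, v_k)` (Voisin I, §2.3.1: `Ω^k ⊆ A^{k,0}`;
Huybrechts, Prop. 2.6.11). [cite: Huybrechts2005, Prop. 2.6.11] -/
theorem IsHolomorphicInCharts.isOfType [IsManifold 𝓘(ℝ, E) ∞ M] {η : MForm 𝓘(ℝ, E) M ℂ k}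
    (hη : IsHolomorphicInCharts η) : Literature.NumberTheory.Transcendental.IsOfType k 0 η := by
  refine ⟨by simp, fun x θ v ↦ ?_⟩
  obtain ⟨a, ha⟩ := hη.exists_apply_eq_restrictScalars x
  rw [ha]
  change a (fun i ↦ Complex.exp (θ * Complex.I) • (show E from v i)) =
    _ * a (fun i ↦ (show E from v i))
  rw [show (a fun i ↦ Complex.exp (θ * Complex.I) • (show E from v i)) =
      (∏ _i : Fin k, Complex.exp (θ * Complex.I)) • a fun i ↦ (show E from v i) from
    a.toAlternatingMap.toMultilinearMap.map_smul_univ (fun _ ↦ Complex.exp (θ * Complex.I)) _]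
  simp only [Finset.prod_const, Finset.card_univ, Fintype.card_fin, smul_eq_mul,
    ← Complex.exp_nat_mul]
  congr 2
  push_cast
  ring

/-- A continuous `ℂ`-alternating form in more than `dim_ℂ E` arguments vanishes: the arguments
are linearly dependent (`LinearIndependent.fintype_card_le_finrank`) and alternating maps kill
dependent families (`AlternatingMap.map_linearDependent`). In particular `Λ^{k+1,0} E^* = 0`
for `dim_ℂ E = k`. [folklore] -/
theorem continuousAlternatingMap_apply_eq_zero_of_finrank_lt [FiniteDimensional ℂ E] {n : ℕ}
    {F : Type*} [NormedAddCommGroup F] [NormedSpace ℂ F] (A : E [⋀^Fin n]→L[ℂ] F)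
    (hn : Module.finrank ℂ E < n) (v : Fin n → E) : A v = 0 := by
  have hli : ¬ LinearIndependent ℂ v := by
    intro hli
    have := hli.fintype_card_le_finrank
    simp only [Fintype.card_fin] at this
    omega
  exact A.toAlternatingMap.map_linearDependent v hli

/-- **The exterior derivative of a top-degree holomorphic form vanishes in the chart.** For `η`
holomorphic in charts and `dim_ℂ E = k`, Mathlib's `extDeriv` of the representative
`η.inChart x` at the chart centre is `0`: its real derivative there is the restriction of
scalars of the `ℂ`-linear derivative `Dg` of the analytic germ `g`, whose values are
`ℂ`-multilinear, so `d(η.inChart x) = Σᵢ (-1)ⁱ Dg(·)(vᵢ)(v₀, …, v̂ᵢ, …, v_k)` is the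
`ℂ`-alternating `(k+1)`-form `alternatizeUncurryFin (Dg)` on the `k`-dimensional `E`, i.e. `0`
(Voisin I, proof of Cor. 7.6 for `p = n`: forms of type `(n+1,0)` vanish).
[cite: VoisinHodgeI2002, Cor. 7.6 (proof, case p = n)] -/
theorem IsHolomorphicInCharts.extDeriv_inChart_eq_zero [FiniteDimensional ℂ E]
    {η : MForm 𝓘(ℝ, E) M ℂ k} (hη : IsHolomorphicInCharts η) (hk : Module.finrank ℂ E = k)
    (x : M) : extDeriv (η.inChart x) (extChartAt 𝓘(ℝ, E) x x) = 0 := by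
  obtain ⟨g, hg, heq⟩ := hη x
  set c := extChartAt 𝓘(ℝ, E) x x
  set R : (E [⋀^Fin k]→L[ℂ] ℂ) →L[ℝ] (E [⋀^Fin k]→L[ℝ] ℂ) :=
    ContinuousAlternatingMap.restrictScalarsCLM (𝕜 := ℂ) (E := E) (F := ℂ) (ι := Fin k) ℝ
    with hRdef
  have hR : HasFDerivAt (fun y ↦ (g y).restrictScalars ℝ)
      (R.comp ((fderiv ℂ g c).restrictScalars ℝ)) c :=
    R.hasFDerivAt.comp c (hg.differentiableAt.hasFDerivAt.restrictScalars ℝ)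
  have h1 : fderiv ℝ (η.inChart x) c = _ := heq.fderiv_eq.trans hR.fderiv
  ext v
  simp only [extDeriv, h1, ContinuousAlternatingMap.alternatizeUncurryFin_apply,
    ContinuousAlternatingMap.coe_zero, Pi.zero_apply]
  have h2 := continuousAlternatingMap_apply_eq_zero_of_finrank_lt
    (ContinuousAlternatingMap.alternatizeUncurryFin (fderiv ℂ g c)) (by omega) v
  rw [ContinuousAlternatingMap.alternatizeUncurryFin_apply] at h2
  simpa [hRdef] using h2

/-- **Top-degree holomorphic forms are closed.** On a complex manifold `M` charted on `E` with
`dim_ℂ E = k`, a `k`-form holomorphic in charts is `d`-closed: `mextDeriv η = 0`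
(`mextDeriv η x` is the chart exterior derivative at the centre, `mextDeriv_eq_extDerivWithin`,
which vanishes by `extDeriv_inChart_eq_zero`). Voisin I, proof of Cor. 7.6, case `p = n`:
"if `α` is holomorphic, then `∂α` … is zero for reasons of type".
[cite: VoisinHodgeI2002, Cor. 7.6 (proof, case p = n)] -/
theorem IsHolomorphicInCharts.isClosedForm [FiniteDimensional ℂ E] [IsManifold 𝓘(ℝ, E) ∞ M]
    {η : MForm 𝓘(ℝ, E) M ℂ k} (hη : IsHolomorphicInCharts η) (hk : Module.finrank ℂ E = k) :
    IsClosedForm η := by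
  funext x
  rw [mextDeriv_eq_extDerivWithin, ModelWithCorners.Boundaryless.range_eq_univ, extDerivWithin_univ]
  exact hη.extDeriv_inChart_eq_zero hk x

/-- A top-degree form holomorphic in charts is a closed smooth complex form, i.e. lies in
`Z^k_ℂ(M)` (`Literature.NumberTheory.Transcendental.cclosedSmoothForms`). [folklore] -/
theorem IsHolomorphicInCharts.mem_cclosedSmoothForms [FiniteDimensional ℂ E]
    [IsManifold 𝓘(ℝ, E) ∞ M] {η : MForm 𝓘(ℝ, E) M ℂ k} (hη : IsHolomorphicInCharts η)
    (hk : Module.finrank ℂ E = k) :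
    η ∈ Literature.NumberTheory.Transcendental.cclosedSmoothForms E M k :=
  Literature.NumberTheory.Transcendental.mem_cclosedSmoothForms hη.isSmoothForm (hη.isClosedForm hk)

end Literature.Geometry.Kaehler

end
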